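import Mathlib
import Literature.Computability.Complexity.CliqueTestGraphs
import Summits.PneNP.PneNP.Theorems.ConvexRankGatesConvexGateBlindExponentDown

/-!
# Crux `ConvexGateBlind` (stmt-PneNP-10680): the Razborov pair at the matrix level — theta's exact ε-window

On COLOURING columns `colorVec h` (`h : Fin m → Fin K`, the complete `K`-partite graph; `K = k - 1` in Razborov's
pair) the one-sided clique distance of a `k`-set `Q` is the number of monochromatic pairs of `Q`, and the Lovász-theta
certificate is an EXACT pure-PSD factorisation at a specific potential:

  `cdist Q (colorVec h) − k(k − K)/(2K) = tr(Θ_h · Y_Q)`,  `Θ_h = (K·[h i = h j] − 1)/(2K) ⪰ 0`, `Y_Q = 1_Q 1_Qᵀ ⪰ 0`,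

both `m × m` (`Θ_h ⪰ 0` is Cauchy–Schwarz over the colour classes: `2K·Θ_h = Bᵀ B` for the class-difference matrix `B`).
For `K = k − 1` the potential is `ε* = k/(2k−2) ∈ (1/2, 1]`: restricted to colourings, the canonical matrix `D − εJ` of the
crux is `PSD_m`-factorisable with `q = m`, `r = 0` at `ε = ε*`, hence (one extra non-negative term) at every `ε ≤ ε*` —
colourings are useless as hard columns for `ε ≤ 1/2` (matrix twin, with the sharp constant, of `Disproof.lean` §B /
`ThetaGateKillsRazborovPair`), while at the unit potential `ε = 1` (line strict-rank-conic-cover, `stub_unitPotentialHard`)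
theta is NOT a factorisation (`tr(Θ_h Y_Q) = (k−2)/(2k−2) > 0` on distance-1 pairs). Registered helper stub:
`colouring_psd_factorisation`. [folklore] (Lovász 1979 sandwich; the computation is elementary).
-/

namespace Summit.PneNP.PneNP.Cruxes.ConvexGateBlind.StrictRankConicCover

open Matrix Finset Filter Literature.Computability.Complexity

noncomputable section

section theta

variable {m K : ℕ}

/-- The (unnormalised) theta certificate of a colouring: `K·[h i = h j] − 1`. [folklore] -/
def thetaCert (h : Fin m → Fin K) : Matrix (Fin m) (Fin m) ℝ :=
  fun i j => (if h i = h j then (K : ℝ) else 0) - 1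

/-- The class-difference matrix `B_{(c,c'), i} = [h i = c] − [h i = c']`. [folklore] -/
def classDiff (h : Fin m → Fin K) : Matrix (Fin K × Fin K) (Fin m) ℝ :=
  fun p i => (if h i = p.1 then 1 else 0) - (if h i = p.2 then 1 else 0)

/-- `Bᵀ B = 2 · (K·[h i = h j] − 1)` (Cauchy–Schwarz over the colour classes, as an identity). [folklore] -/
theorem classDiff_transpose_mul (h : Fin m → Fin K) :
    (classDiff h)ᵀ * classDiff h = (2 : ℝ) • thetaCert h := by
  ext i j
  simp only [mul_apply, transpose_apply, Matrix.smul_apply, smul_eq_mul, thetaCert, classDiff]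
  rw [Fintype.sum_prod_type]
  set f : Fin K → ℝ := fun c => if h i = c then 1 else 0 with hf
  set g : Fin K → ℝ := fun c => if h j = c then 1 else 0 with hg
  have hfs : ∑ c, f c = 1 := by simp [hf, Finset.sum_ite_eq]
  have hgs : ∑ c, g c = 1 := by simp [hg, Finset.sum_ite_eq]
  have hfg : ∑ c, f c * g c = if h i = h j then 1 else 0 := by
    have : ∀ c, f c * g c = if h i = c then g c else 0 := fun c => by
      simp only [hf]; split_ifs <;> simp
    simp_rw [this, Finset.sum_ite_eq, Finset.mem_univ, if_true, hg]
    by_cases hij : h i = h j <;> simp [hij, eq_comm]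
  have hK : ∀ x : ℝ, ∑ _c : Fin K, x = K * x := fun x => by simp
  calc ∑ c, ∑ c', (f c - f c') * (g c - g c')
      = ∑ c, ∑ c', (f c * g c - f c * g c' - f c' * g c + f c' * g c') :=
        Finset.sum_congr rfl fun c _ => Finset.sum_congr rfl fun c' _ => by ring
    _ = ∑ c, ((K : ℝ) * (f c * g c) - f c * ∑ c', g c' - g c * ∑ c', f c' + ∑ c', f c' * g c') := by
        refine Finset.sum_congr rfl fun c _ => ?_
        rw [Finset.sum_add_distrib, Finset.sum_sub_distrib, Finset.sum_sub_distrib, hK, Finset.mul_sum, Finset.mul_sum]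
        refine congrArg₂ _ (congrArg₂ _ rfl ?_) rfl
        exact Finset.sum_congr rfl fun c' _ => by ring
    _ = (K : ℝ) * ∑ c, f c * g c - (∑ c, f c) * (∑ c', g c') - (∑ c, g c) * (∑ c', f c') +
          K * ∑ c', f c' * g c' := by
        rw [Finset.sum_add_distrib, Finset.sum_sub_distrib, Finset.sum_sub_distrib, hK, Finset.mul_sum, Finset.sum_mul,
          Finset.sum_mul]
    _ = 2 * ((if h i = h j then (K : ℝ) else 0) - 1) := by
        rw [hfg, hfs, hgs]
        split_ifs <;> ring

/-- The theta certificate is positive semidefinite. [folklore] -/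
theorem thetaCert_posSemidef (h : Fin m → Fin K) : (thetaCert h).PosSemidef := by
  have hB : ((classDiff h)ᵀ * classDiff h).PosSemidef := by
    simpa using posSemidef_conjTranspose_mul_self (classDiff h)
  have : thetaCert h = (2 : ℝ)⁻¹ • ((classDiff h)ᵀ * classDiff h) := by
    rw [classDiff_transpose_mul, smul_smul]; norm_num
  rw [this]
  exact hB.smul (by norm_num)

/-- The indicator vector of `Q`. [folklore] -/
def indVec (Q : Finset (Fin m)) : Fin m → ℝ := fun i => if i ∈ Q then 1 else 0

/-- The Gram matrix `1_Q 1_Qᵀ` of the indicator of `Q`. [folklore] -/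
def indGram (Q : Finset (Fin m)) : Matrix (Fin m) (Fin m) ℝ := vecMulVec (indVec Q) (indVec Q)

/-- `1_Q 1_Qᵀ ⪰ 0`. [folklore] -/
theorem indGram_posSemidef (Q : Finset (Fin m)) : (indGram Q).PosSemidef := by
  have := posSemidef_vecMulVec_self_star (indVec Q)
  simpa [indGram] using this

/-- `tr(Θ · 1_Q 1_Qᵀ) = Σ_{i,j ∈ Q} Θ_{ij}` for the theta certificate: `K · #{(i,j) ∈ Q × Q : h i = h j} − (#Q)²`.
[folklore] -/
theorem trace_thetaCert_indGram (h : Fin m → Fin K) (Q : Finset (Fin m)) :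
    (thetaCert h * indGram Q).trace =
      (K : ℝ) * ((Q ×ˢ Q).filter fun p => h p.1 = h p.2).card - (Q.card : ℝ) ^ 2 := by
  classical
  have hentry : ∀ i j : Fin m,
      ((if h i = h j then (K : ℝ) else 0) - 1) * ((if j ∈ Q then (1 : ℝ) else 0) * (if i ∈ Q then 1 else 0)) =
        if i ∈ Q then (if j ∈ Q then ((if h i = h j then (K : ℝ) else 0) - 1) else 0) else 0 := by
    intro i j
    split_ifs <;> simp
  simp only [Matrix.trace, Matrix.diag, mul_apply, indGram, vecMulVec_apply, indVec, thetaCert, hentry]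
  have hrestrict : (∑ x : Fin m, ∑ y : Fin m,
      if x ∈ Q then (if y ∈ Q then ((if h x = h y then (K : ℝ) else 0) - 1) else 0) else 0) =
        ∑ x ∈ Q, ∑ y ∈ Q, ((if h x = h y then (K : ℝ) else 0) - 1) := by
    have h1 : ∀ x : Fin m, (∑ y : Fin m,
        if x ∈ Q then (if y ∈ Q then ((if h x = h y then (K : ℝ) else 0) - 1) else 0) else 0) =
          if x ∈ Q then ∑ y ∈ Q, ((if h x = h y then (K : ℝ) else 0) - 1) else 0 := by
      intro x
      by_cases hx : x ∈ Q
      · simp only [if_pos hx]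
        rw [← Finset.sum_subset (Finset.subset_univ Q)]
        · exact Finset.sum_congr rfl fun y hy => if_pos hy
        · intro y _ hy
          exact if_neg hy
      · simp [hx]
    simp_rw [h1]
    rw [← Finset.sum_subset (Finset.subset_univ Q)]
    · exact Finset.sum_congr rfl fun x hx => if_pos hx
    · intro x _ hx
      exact if_neg hx
  rw [hrestrict]
  -- now `∑ i ∈ Q, ∑ j ∈ Q, (K·[h i = h j] − 1)`
  simp only [Finset.sum_sub_distrib, Finset.sum_const, nsmul_eq_mul, mul_one]
  have hcount : ∑ i ∈ Q, ∑ j ∈ Q, (if h i = h j then (K : ℝ) else 0) =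
      (K : ℝ) * ((Q ×ˢ Q).filter fun p => h p.1 = h p.2).card := by
    rw [← Finset.sum_product (s := Q) (t := Q) (f := fun p => if h p.1 = h p.2 then (K : ℝ) else 0)]
    rw [Finset.natCast_card_filter, Finset.mul_sum]
    exact Finset.sum_congr rfl fun p _ => by split_ifs <;> simp
  rw [hcount]
  ring

/-! ### `cdist` on colouring columns = monochromatic pairs -/

/-- The colouring vector is OFF on an edge iff the edge is monochromatic. [folklore] -/
theorem colorVec_mk_eq_false (h : Fin m → Fin K) {x y : Fin m} (hxy : s(x, y) ∈ (⊤ : SimpleGraph (Fin m)).edgeSet) :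
    colorVec h ⟨s(x, y), hxy⟩ = false ↔ h x = h y := by
  simp [colorVec]

open Classical in
/-- The ordered monochromatic pairs of distinct vertices of `Q`. [folklore] -/
def monoPairs (h : Fin m → Fin K) (Q : Finset (Fin m)) : Finset (Fin m × Fin m) :=
  Q.offDiag.filter fun p => h p.1 = h p.2

/-- Membership in `monoPairs`. [folklore] -/
theorem mem_monoPairs {h : Fin m → Fin K} {Q : Finset (Fin m)} {p : Fin m × Fin m} :
    p ∈ monoPairs h Q ↔ p.1 ∈ Q ∧ p.2 ∈ Q ∧ p.1 ≠ p.2 ∧ h p.1 = h p.2 := by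
  classical
  simp [monoPairs, Finset.mem_offDiag, and_assoc]

open Classical in
/-- **Twice the clique distance to a colouring column is the number of ordered monochromatic pairs.** [folklore] -/
theorem two_mul_cdist_colorVec (h : Fin m → Fin K) (Q : Finset (Fin m)) :
    2 * cdist Q (colorVec h) = ((monoPairs h Q).card : ℝ) := by
  -- `cdist = #A`, `A` = monochromatic edges inside `Q`
  set A : Finset (Edge m) := univ.filter fun e => cliqueVec Q e = true ∧ colorVec h e = false with hA
  have hcd : cdist Q (colorVec h) = (A.card : ℝ) := by
    unfold cdist
    rw [hA, Finset.natCast_card_filter]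
  -- double count ordered pairs over their edge
  have hmem : ∀ {x y : Fin m} (hxy : s(x, y) ∈ (⊤ : SimpleGraph (Fin m)).edgeSet),
      (⟨s(x, y), hxy⟩ : Edge m) ∈ A ↔ x ∈ Q ∧ y ∈ Q ∧ h x = h y := by
    intro x y hxy
    simp only [hA, Finset.mem_filter, Finset.mem_univ, true_and, colorVec_mk_eq_false]
    simp [cliqueVec, and_assoc]
  have hfib : ∀ e ∈ A, ((monoPairs h Q).filter fun p => s(p.1, p.2) = (e : Sym2 (Fin m))).card = 2 := by
    rintro ⟨e, he⟩ heA
    induction e using Sym2.ind with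
    | h x y =>
      have hxy : x ≠ y := by simpa using he
      obtain ⟨hx, hy, hh⟩ := (hmem he).1 heA
      have : ((monoPairs h Q).filter fun p => s(p.1, p.2) = s(x, y)) = {(x, y), (y, x)} := by
        ext ⟨a, b⟩
        simp only [Finset.mem_filter, mem_monoPairs, Finset.mem_insert, Finset.mem_singleton, Prod.mk.injEq,
          Sym2.eq_iff]
        constructor
        · rintro ⟨-, ⟨rfl, rfl⟩ | ⟨rfl, rfl⟩⟩
          · exact Or.inl ⟨rfl, rfl⟩
          · exact Or.inr ⟨rfl, rfl⟩
        · rintro (⟨rfl, rfl⟩ | ⟨rfl, rfl⟩)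
          · exact ⟨⟨hx, hy, hxy, hh⟩, Or.inl ⟨rfl, rfl⟩⟩
          · exact ⟨⟨hy, hx, hxy.symm, hh.symm⟩, Or.inr ⟨rfl, rfl⟩⟩
      rw [this, Finset.card_pair]
      simpa [Prod.ext_iff] using fun h' : x = y => (hxy h').elim
  have hH : ∀ p ∈ monoPairs h Q, s(p.1, p.2) ∈ A.map (Function.Embedding.subtype _) := by
    rintro ⟨x, y⟩ hp
    obtain ⟨hx, hy, hne, hh⟩ := mem_monoPairs.1 hp
    have hxy : s(x, y) ∈ (⊤ : SimpleGraph (Fin m)).edgeSet := by simpa using hne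
    exact Finset.mem_map.2 ⟨⟨s(x, y), hxy⟩, (hmem hxy).2 ⟨hx, hy, hh⟩, rfl⟩
  have hcount := Finset.card_eq_sum_card_fiberwise hH
  rw [Finset.sum_map] at hcount
  simp only [Function.Embedding.coe_subtype] at hcount
  rw [Finset.sum_congr rfl hfib, Finset.sum_const, smul_eq_mul] at hcount
  rw [hcd, hcount]
  push_cast
  ring

open Classical in
/-- All ordered pairs of `Q` with equal colours: the diagonal plus the monochromatic off-diagonal pairs. [folklore] -/
theorem card_filter_prod_eq (h : Fin m → Fin K) (Q : Finset (Fin m)) :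
    ((Q ×ˢ Q).filter fun p => h p.1 = h p.2).card = Q.card + (monoPairs h Q).card := by
  rw [← Finset.diag_union_offDiag, Finset.filter_union,
    Finset.card_union_of_disjoint ((Finset.disjoint_diag_offDiag Q).mono (Finset.filter_subset _ _)
      (Finset.filter_subset _ _))]
  congr 1
  rw [Finset.filter_true_of_mem, Finset.diag_card]
  intro p hp
  rw [(Finset.mem_diag.1 hp).2]

/-- **Theta's exact identity on colouring columns.** For `h : Fin m → Fin K` (`1 ≤ K`) and a `k`-set `Q`:
`cdist Q (colorVec h) − k(k − K)/(2K) = tr(Θ_h · 1_Q 1_Qᵀ)` with `Θ_h = thetaCert h / (2K) ⪰ 0`. [folklore] -/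
theorem cdist_colorVec_theta (h : Fin m → Fin K) (hK : 1 ≤ K) (Q : Finset (Fin m)) {k : ℕ} (hQ : Q.card = k) :
    cdist Q (colorVec h) - (k : ℝ) * ((k : ℝ) - K) / (2 * K) =
      (((2 * (K : ℝ))⁻¹ • thetaCert h) * indGram Q).trace := by
  rw [Matrix.smul_mul, Matrix.trace_smul, trace_thetaCert_indGram, card_filter_prod_eq, hQ, smul_eq_mul]
  have h2 := two_mul_cdist_colorVec h Q
  have hKpos : (0 : ℝ) < K := by exact_mod_cast hK
  push_cast
  field_simp
  linear_combination (K : ℝ) * h2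

end theta

/-- **Registered helper stub (theta's ε-window on the Razborov pair).** For `2 ≤ k` there are PSD matrices
`H_h` (one per `(k−1)`-colouring `h`, `m × m`) and `Y_Q` (one per vertex set) such that on every `k`-set `Q`
`cdist Q (colorVec h) − k/(2(k−1)) = tr(H_h Y_Q)`: restricted to colouring columns the canonical matrix `D − εJ` of the
crux is `PSD_m`-factorisable (`q = m`, `r = 0`) at `ε = k/(2k−2) ∈ (1/2, 1]` — hence at every smaller `ε` with one more
non-negative term — while at the unit potential theta is not a factorisation. (`H_h = thetaCert h/(2k−2)`,
`Y_Q = 1_Q 1_Qᵀ`; Lovász's sandwich at the matrix level.) [folklore] -/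
theorem colouring_psd_factorisation :
    ∀ (m k : ℕ), 2 ≤ k →
      ∃ (H : (Fin m → Fin (k - 1)) → Matrix (Fin m) (Fin m) ℝ) (Y : Finset (Fin m) → Matrix (Fin m) (Fin m) ℝ),
        (∀ h, (H h).PosSemidef) ∧ (∀ Q, (Y Q).PosSemidef) ∧
          ∀ (h : Fin m → Fin (k - 1)) (Q : Finset (Fin m)), Q.card = k →
            cdist Q (colorVec h) - (k : ℝ) / (2 * (k - 1)) = (H h * Y Q).trace := by
  intro m k hk
  refine ⟨fun h => (2 * ((k - 1 : ℕ) : ℝ))⁻¹ • thetaCert h, fun Q => indGram Q,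
    fun h => (thetaCert_posSemidef h).smul (by positivity), fun Q => indGram_posSemidef Q, fun h Q hQ => ?_⟩
  have hK : 1 ≤ k - 1 := by omega
  have := cdist_colorVec_theta h hK Q hQ
  have hcast : ((k - 1 : ℕ) : ℝ) = (k : ℝ) - 1 := by
    rw [Nat.cast_sub (by omega)]; norm_num
  rw [hcast] at this ⊢
  have hk1 : (0 : ℝ) < (k : ℝ) - 1 := by
    have : (2 : ℝ) ≤ k := by exact_mod_cast hk
    linarith
  rw [← this]
  congr 1
  field_simp
  ring


end

end Summit.PneNP.PneNP.Cruxes.ConvexGateBlind.StrictRankConicCover
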